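import Summits.BirchSwinnertonDyer.Rank1Residual.Additive.CyclotomicThreeRankOneCardIdentity
import Literature.NumberTheory.EllipticCurves.BSDInvariantsRegulatorProofs
import Literature.NumberTheory.EllipticCurves.BSDInvariantsPositivityProofs
import HarnessLib

/-!
# Rank `(1,0)` descent data over a quadratic field — the generator of `V(K)/tors` versus the
# generator of the TWIST `W(ℚ)` through a twisting transport `Φ : W(ℚ) →+ V(K)`, the transfer of the
# `p`-adic and Néron–Tate heights, and Milne's Weil-restriction identity with the regulators eliminated
# (cell `b2b-bsdres`, team n1011, seat p16, sub-target (S8) of OWNERS row T-N11-GK3LOW)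

HONEST FRAMING (cell `b2b-bsdres`, run/shared/lean/b2b/bsd-rank1-residual/, verbatim in every
file): the goal of the cell is to DELETE the COMBINATION-SHAPED residual classes of the
Birch–Swinnerton-Dyer formula for ALL analytic-rank `≤ 1` elliptic curves over `ℚ` — "full BSD
formula for every rank `≤ 1` curve in class `C`" assembled STRICTLY from published theorems — so
that the rank-`≤ 1` remainder becomes exactly the CONSTRUCTION-SHAPED classes, which are TYPED
(missing-input `Prop`s), NOT attempted. This is not "finishing BSD". Team n1011 (N10 / N11), seat
p16: research route; the labels of X3 / X4 and the N10 / N11 / O7 marks are UNCHANGED by this file;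
nothing is booked here.

Theorems only (no `def`, no `sorry`, no named fact). The `(r_W, r_V) = (1, 0)` twin of additive-p4's
`CyclotomicThreeRankOneDescentData` / `CyclotomicThreeRankOneCardIdentity` (line V17, ranks `(0,1)`):
`V/ℚ` with `V(ℚ)` FINITE, its twist `W = C • V^{(c)}` of rank one (`{P₁}` a Mordell–Weil basis of
`W(ℚ)`), `K ⊇ ℚ(√c)` quadratic, so that `V(K)` has rank `0 + 1 = 1` (`{Q}` a basis). The generator of
`V(K)/tors` now comes from `W(ℚ)`: through ANY additive map `Φ : W(ℚ) →+ V(K)` multiplying Néron–Tate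
heights by `[K:ℚ] = 2` — the twisting isomorphism `W_K ≅ V_K` composed with the inclusion is one
(`exists_twistTransport`, built from the tree's `QuadraticDescent.twistMap`) — one has `Φ P₁ = m • Q + t`
with `t` torsion for SOME integer `m` (no index lemma is needed downstream: `m` cancels between the
`p`-adic leading term and Milne's identity), and

* `padicHeightK_twistGenerator_eq` — for a `K`-height datum `DK` on `V(K)` restricting ALONG `Φ` to
  twice a `ℚ`-datum `Dh` on `W(ℚ)` (`DK(ΦP, ΦP') = 2·Dh(P,P')`, Delbourgo's normalisation
  `⟨,⟩_{p,ℚ} := [K:ℚ]⁻¹⟨,⟩^{Sch}_{p,K}` of the height of `W` at an additive potentially good ordinary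
  prime, J. Number Theory 95 (2002) p. 39): `m² · DK(Q,Q) = 2 · Dh(P₁,P₁)`;
* `heightPairing_twistGenerator_eq` — Néron–Tate: `m² · ⟨Q,Q⟩_K = 2 · ⟨P₁,P₁⟩_ℚ`;
* `card_identity_baseChange_rankOneZero` — Milne's identity (tree fact
  `Milne1972.bsdQuotient_baseChange_quadratic_anyModel`, hypothesis `hWR`) as an identity of RATIONALS:
  **`2·C(V⊗K)·#Ш(V_K)·#V(ℚ)²·#W(ℚ)_tors² = m²·n_V·|u_C|·#Ш(V)·#Ш(W)·∏c(V)·∏c(W)·#V(K)_tors²`**, and its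
  `p`-adic valuation form `padicVal_card_identity_rankOneZero` (any prime `p`; `ord_p m²` kept as a term);
* `heightPairing_congrEquiv` (transport along an equality of equations preserves the pairing) and
  `exists_twistTransport` — **existence of `Φ`** with `⟨ΦP, ΦP⟩_K = 2⟨P,P⟩_ℚ`: `Φ = e₁⁻¹ ∘ τ ∘ e₀⁻¹` with
  `τ : V^{(c)}(ℚ) → V^{(1)}(K)` the twisting map `(X,Y) ↦ (X/θ², Y/θ³)` (Silverman *AEC* X.5.4,
  `QuadraticDescent.twistMap`), `e₀ : V^{(c)}(ℚ) ≃ W(ℚ)` (`C`) and `e₁ : V(K) ≃ V^{(1)}(K)` (completing the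
  square) the changes of variables — all three preserve canonical heights up to the factor `[K:ℚ]` of
  the inclusion (Silverman *AEC* VIII.5.4(b), VIII.9.3).

These feed the `(r_an V, r_an W) = (0,1)` `K`-side LOWER theorem at `p = 3`
(`XGordRankOneZeroCyclotomicThreeLowerK.lean`).
-/

noncomputable section

open scoped Classical

open WeierstrassCurve WeierstrassCurve.Affine.Point Literature.NumberTheory.EllipticCurves NumberField

namespace Summit.BirchSwinnertonDyer.Rank1Residual.Additive

/-! ## §1 Heights of the two generators through a twisting transport `Φ` -/

section Heights

variable (K : Type) [Field K] [NumberField K] (V : WeierstrassCurve ℚ) [V.IsElliptic]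
  (W : WeierstrassCurve ℚ) [W.IsElliptic]

omit [V.IsElliptic] [W.IsElliptic] in
/-- **`p`-adic heights of the two generators.** For a `K`-height datum `DK` on `V(K)` restricting
along `Φ : W(ℚ) →+ V(K)` to twice a `ℚ`-datum `Dh` on `W(ℚ)` (`DK(ΦP, ΦP') = 2·Dh(P,P')`), and
`Φ P₁ = m • Q + t` with `t` torsion: `m² · DK(Q,Q) = 2 · Dh(P₁,P₁)`.
[cite: Delbourgo2002, p. 39 (⟨,⟩_{p,ℚ} := [K:ℚ]⁻¹⟨,⟩^{Sch}_{p,K})] [cite: MazurTateTeitelbaum1986Invent, §II.4] -/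
theorem padicHeightK_twistGenerator_eq {p : ℕ} [Fact p.Prime] (DK : PAdicHeightDataK V p K)
    (Dh : PAdicHeightData W p) (Φ : W.toAffine.Point →+ (V.baseChange K).toAffine.Point)
    (hres : ∀ P P' : W.toAffine.Point, DK.pairing (Φ P) (Φ P') = 2 * Dh.pairing P P')
    {P₁ : W.toAffine.Point} {Q : (V.baseChange K).toAffine.Point} {m : ℤ}
    {t : (V.baseChange K).toAffine.Point} (ht : IsOfFinAddOrder t) (hmQ : Φ P₁ = m • Q + t) :
    (m : ℚ_[p]) ^ 2 * DK.pairing Q Q = 2 * Dh.pairing P₁ P₁ := by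
  have h := hres P₁ P₁
  rwa [hmQ, pairing_zsmul_add_torsion_self DK.pairing DK.map_torsion DK.symm m Q t ht] at h

omit [V.IsElliptic] [W.IsElliptic] in
/-- **Néron–Tate heights of the two generators**: if `Φ : W(ℚ) →+ V(K)` doubles Néron–Tate heights
(`⟨ΦP, ΦP⟩_K = 2⟨P,P⟩_ℚ`, e.g. the twisting isomorphism followed by the inclusion, Silverman *AEC*
VIII.5.4(b)) and `Φ P₁ = m • Q + t` with `t` torsion, then `m² · ⟨Q,Q⟩_K = 2 · ⟨P₁,P₁⟩_ℚ`.
[cite: SilvermanAEC2009, Prop. VIII.5.4(b) and Thm. VIII.9.3] -/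
theorem heightPairing_twistGenerator_eq [(V.baseChange K).IsElliptic]
    (Φ : W.toAffine.Point →+ (V.baseChange K).toAffine.Point)
    (hΦ : ∀ P : W.toAffine.Point, heightPairing (Φ P) (Φ P) = 2 * heightPairing P P)
    {P₁ : W.toAffine.Point} {Q : (V.baseChange K).toAffine.Point} {m : ℤ}
    {t : (V.baseChange K).toAffine.Point} (ht : IsOfFinAddOrder t) (hmQ : Φ P₁ = m • Q + t) :
    (m : ℝ) ^ 2 * heightPairing Q Q = 2 * heightPairing P₁ P₁ := by
  have h := hΦ P₁
  rw [hmQ] at h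
  have e1 : ∀ R : (V.baseChange K).toAffine.Point,
      heightPairing R (m • Q + t) = (m : ℝ) * heightPairing R Q := by
    intro R
    rw [heightPairing_add_right, heightPairing_zsmul_right,
      heightPairing_eq_zero_of_isOfFinAddOrder_right R ht, add_zero]
  rw [e1, heightPairing_symm, e1] at h
  linear_combination h

end Heights

/-! ## §2 Milne's identity in rank `(1,0)`, regulators eliminated -/

section OverQuadratic

variable (K : Type) [Field K] [NumberField K]
  (V : WeierstrassCurve ℚ) [V.IsElliptic] [V.IsGloballyMinimal]
  (W : WeierstrassCurve ℚ) [W.IsElliptic] [W.IsGloballyMinimal]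

omit [V.IsGloballyMinimal] [W.IsGloballyMinimal] in
/-- **Milne's identity in rank `(1,0)` as an identity of rationals.** `K` imaginary quadratic,
`W = C • V^{(d_K)}` globally minimal of rank ONE with Mordell–Weil basis `{P₁}`, `V(ℚ)` FINITE, `{Q}` a
Mordell–Weil basis of `V(K)`, `Φ : W(ℚ) →+ V(K)` doubling Néron–Tate heights with `Φ P₁ = m • Q + t`
(`t` torsion); Milne's Weil-restriction identity for the model `V ⊗ K` (`hWR`, the conclusion of
`Milne1972.bsdQuotient_baseChange_quadratic_anyModel`). Then
`2 · C(V⊗K) · #Ш(V_K) · #V(ℚ)² · #W(ℚ)_tors² = m² · n_V · |u_C| · #Ш(V) · #Ш(W) · ∏c(V) · ∏c(W) · #V(K)_tors²`: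
the periods cancel by `Ω(V)·Ω(V^{(d_K)}) = n_V · Ω(V_K/K)` and `Ω(W) = |u_C|·Ω(V^{(d_K)})`, the
regulators by `m²·Reg(V_K) = 2·Reg(W)` (`heightPairing_twistGenerator_eq`), `Reg(V) = 1`.
[cite: Milne1972ArithmeticAV, §1 Thm. 1 and §2 (through DokchitserDokchitserAnnals2010, §2.1)]
[cite: SilvermanAEC2009, Prop. VIII.5.4(b)] -/
theorem card_identity_baseChange_rankOneZero [IsTotallyComplex K] (h2 : Module.finrank ℚ K = 2)
    {C : VariableChange ℚ} (hC : C • V.quadraticTwist (NumberField.discr K : ℚ) = W)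
    [Finite V.toAffine.Point]
    {P₁ : W.toAffine.Point} (hP₁ : IsMordellWeilBasis (fun _ : Fin 1 => P₁))
    {Q : (V.baseChange K).toAffine.Point} (hQ : IsMordellWeilBasis (fun _ : Fin 1 => Q))
    (Φ : W.toAffine.Point →+ (V.baseChange K).toAffine.Point)
    (hΦ : ∀ P : W.toAffine.Point, heightPairing (Φ P) (Φ P) = 2 * heightPairing P P)
    {m : ℤ} {t : (V.baseChange K).toAffine.Point} (ht : IsOfFinAddOrder t)
    (hmQ : Φ P₁ = m • Q + t)
    (hWR : ((V.baseChange K).shaOrder : ℝ) * (V.baseChange K).regulator * (V.baseChange K).bsdPeriod *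
        ((V.baseChange K).modifiedTamagawaProduct : ℝ) / ((V.baseChange K).torsionOrder : ℝ) ^ 2 =
      V.bsdRHS * W.bsdRHS) :
    (2 * (V.baseChange K).modifiedTamagawaProduct * (V.baseChange K).shaOrder *
        (Nat.card V.toAffine.Point : ℚ) ^ 2 * (W.torsionOrder : ℚ) ^ 2 : ℚ) =
      (m : ℚ) ^ 2 * (V.baseChange ℝ).numRealComponents * |(C.u : ℚ)| * V.shaOrder * W.shaOrder *
        V.tamagawaProduct * W.tamagawaProduct * ((V.baseChange K).torsionOrder : ℚ) ^ 2 := by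
  haveI : (V.baseChange K).IsElliptic := by rw [WeierstrassCurve.baseChange]; infer_instance
  have hP : 0 < (V.baseChange K).bsdPeriod := bsdPeriod_pos' _
  have hΩW : W.realPeriodRat =
      |((C.u : ℚ) : ℝ)| * (V.quadraticTwist (NumberField.discr K : ℚ)).realPeriodRat := by
    rw [← hC]
    exact (V.quadraticTwist (NumberField.discr K : ℚ)).realPeriodRat_smul_holds C
  have hA : V.realPeriodRat * (V.quadraticTwist (NumberField.discr K : ℚ)).realPeriodRat =
      ((V.baseChange ℝ).numRealComponents : ℝ) * (V.baseChange K).bsdPeriod :=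
    realPeriod_mul_realPeriod_quadraticTwist_eq_mul_bsdPeriod V K h2
  -- the regulators
  have hRK : (V.baseChange K).regulator = heightPairing Q Q :=
    regulator_eq_heightPairing_of_isMordellWeilBasis_one hQ
  have hRW : W.regulator = heightPairing P₁ P₁ := regulator_eq_heightPairing_of_isMordellWeilBasis_one hP₁
  have hRWpos : 0 < W.regulator := regulator_pos_holds W
  have hreg : (m : ℝ) ^ 2 * (V.baseChange K).regulator = 2 * W.regulator := by
    rw [hRK, hRW]
    exact heightPairing_twistGenerator_eq K V W Φ hΦ ht hmQ
  rw [V.bsdRHS_eq_of_finite, bsdRHS_def, hΩW] at hWR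
  have hNK : ((V.baseChange K).torsionOrder : ℝ) ≠ 0 := by
    exact_mod_cast ((V.baseChange K).torsionOrder_pos (V.baseChange K).finite_torsion_holds).ne'
  have hNV : (Nat.card V.toAffine.Point : ℝ) ≠ 0 := by
    exact_mod_cast (Nat.card_pos (α := V.toAffine.Point)).ne'
  have hNW : (W.torsionOrder : ℝ) ≠ 0 := by exact_mod_cast (W.torsionOrder_pos W.finite_torsion_holds).ne'
  -- clear denominators in `ℝ`
  have hWR' : ((V.baseChange K).shaOrder : ℝ) * (V.baseChange K).regulator * (V.baseChange K).bsdPeriod *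
        ((V.baseChange K).modifiedTamagawaProduct : ℝ) *
        ((Nat.card V.toAffine.Point : ℝ) ^ 2 * (W.torsionOrder : ℝ) ^ 2) =
      (V.shaOrder : ℝ) * V.realPeriodRat * (V.tamagawaProduct : ℝ) *
        ((W.shaOrder : ℝ) * W.regulator * (|((C.u : ℚ) : ℝ)| *
          (V.quadraticTwist (NumberField.discr K : ℚ)).realPeriodRat) * (W.tamagawaProduct : ℝ)) *
        ((V.baseChange K).torsionOrder : ℝ) ^ 2 := by
    have h := hWR
    field_simp at h
    linear_combination h
  -- multiply by `m²`, substitute `m² Reg_K = 2 Reg(W)` and `Ω(V)Ω(V^{(d)}) = n P`, cancel `Reg(W) · P`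
  have key : ((2 : ℝ) * ((V.baseChange K).modifiedTamagawaProduct : ℝ) * ((V.baseChange K).shaOrder : ℝ) *
        (Nat.card V.toAffine.Point : ℝ) ^ 2 * (W.torsionOrder : ℝ) ^ 2) *
        (W.regulator * (V.baseChange K).bsdPeriod) =
      (((m : ℝ) ^ 2 * ((V.baseChange ℝ).numRealComponents : ℝ) * |((C.u : ℚ) : ℝ)| * (V.shaOrder : ℝ) *
        (W.shaOrder : ℝ) * (V.tamagawaProduct : ℝ) * (W.tamagawaProduct : ℝ) *
        ((V.baseChange K).torsionOrder : ℝ) ^ 2)) * (W.regulator * (V.baseChange K).bsdPeriod) := by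
    linear_combination ((m : ℝ) ^ 2) * hWR'
      - (((V.baseChange K).modifiedTamagawaProduct : ℝ) * ((V.baseChange K).shaOrder : ℝ) *
          (Nat.card V.toAffine.Point : ℝ) ^ 2 * (W.torsionOrder : ℝ) ^ 2 * (V.baseChange K).bsdPeriod) * hreg
      + ((m : ℝ) ^ 2 * |((C.u : ℚ) : ℝ)| * (V.shaOrder : ℝ) * (W.shaOrder : ℝ) * W.regulator *
          (V.tamagawaProduct : ℝ) * (W.tamagawaProduct : ℝ) * ((V.baseChange K).torsionOrder : ℝ) ^ 2) * hA
  have key' := mul_right_cancel₀ (mul_ne_zero hRWpos.ne' hP.ne') key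
  exact_mod_cast key'

omit [V.IsGloballyMinimal] [W.IsGloballyMinimal] in
/-- **Milne's rank-`(1,0)` identity in `p`-adic valuations** (any prime `p`; the term `ord_p m²` is
kept — downstream it cancels against the same term of the `p`-adic leading-term identity):
`ord_p C(V⊗K) + ord_p #Ш(V_K) + 2 ord_p #V(ℚ) + 2 ord_p #W(ℚ)_tors =
 ord_p m² + ord_p |u_C| + ord_p #Ш(V) + ord_p #Ш(W) + ord_p ∏c(V) + ord_p ∏c(W) + 2 ord_p #V(K)_tors`
(`p` odd, so `ord_p 2 = ord_p n_V = 0`; `ord_p m² = 2 ord_p m`). [cite: Milne1972ArithmeticAV, §1 Thm. 1] -/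
theorem padicVal_card_identity_rankOneZero [IsTotallyComplex K] (h2 : Module.finrank ℚ K = 2)
    (p : ℕ) [Fact p.Prime] (hp : p ≠ 2)
    {C : VariableChange ℚ} (hC : C • V.quadraticTwist (NumberField.discr K : ℚ) = W)
    [Finite V.toAffine.Point] (hfinV : V.ShaFinite) (hfinW : W.ShaFinite)
    (hshaK : (V.baseChange K).ShaFinite)
    {P₁ : W.toAffine.Point} (hP₁ : IsMordellWeilBasis (fun _ : Fin 1 => P₁))
    {Q : (V.baseChange K).toAffine.Point} (hQ : IsMordellWeilBasis (fun _ : Fin 1 => Q))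
    (Φ : W.toAffine.Point →+ (V.baseChange K).toAffine.Point)
    (hΦ : ∀ P : W.toAffine.Point, heightPairing (Φ P) (Φ P) = 2 * heightPairing P P)
    {m : ℤ} {t : (V.baseChange K).toAffine.Point} (ht : IsOfFinAddOrder t)
    (hmQ : Φ P₁ = m • Q + t)
    (hWR : ((V.baseChange K).shaOrder : ℝ) * (V.baseChange K).regulator * (V.baseChange K).bsdPeriod *
        ((V.baseChange K).modifiedTamagawaProduct : ℝ) / ((V.baseChange K).torsionOrder : ℝ) ^ 2 =
      V.bsdRHS * W.bsdRHS) :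
    (V.baseChange K).modifiedTamagawaProduct ≠ 0 ∧ m ≠ 0 ∧
    padicValRat p (V.baseChange K).modifiedTamagawaProduct + padicValNat p (V.baseChange K).shaOrder +
        2 * padicValNat p (Nat.card V.toAffine.Point) + 2 * padicValNat p W.torsionOrder =
      2 * padicValRat p (m : ℚ) + padicValRat p |(C.u : ℚ)| + padicValNat p V.shaOrder +
        padicValNat p W.shaOrder + padicValNat p V.tamagawaProduct + padicValNat p W.tamagawaProduct +
        2 * padicValNat p (V.baseChange K).torsionOrder := by
  haveI : (V.baseChange K).IsElliptic := by rw [WeierstrassCurve.baseChange]; infer_instance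
  have hcard := card_identity_baseChange_rankOneZero K V W h2 hC hP₁ hQ Φ hΦ ht hmQ hWR
  have hnV0 : ((V.baseChange ℝ).numRealComponents : ℚ) ≠ 0 := by
    rw [numRealComponents]; split_ifs <;> norm_num
  have hSV0 : (V.shaOrder : ℚ) ≠ 0 := by exact_mod_cast (V.shaOrder_pos hfinV).ne'
  have hSW0 : (W.shaOrder : ℚ) ≠ 0 := by exact_mod_cast (W.shaOrder_pos hfinW).ne'
  have hSK0 : ((V.baseChange K).shaOrder : ℚ) ≠ 0 := by
    exact_mod_cast ((V.baseChange K).shaOrder_pos hshaK).ne'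
  have hcV0 : (V.tamagawaProduct : ℚ) ≠ 0 := by exact_mod_cast V.tamagawaProduct_pos_holds.ne'
  have hcW0 : (W.tamagawaProduct : ℚ) ≠ 0 := by exact_mod_cast W.tamagawaProduct_pos_holds.ne'
  have hNV0 : ((Nat.card V.toAffine.Point : ℕ) : ℚ) ≠ 0 := by exact_mod_cast Nat.card_pos.ne'
  have hNW0 : (W.torsionOrder : ℚ) ≠ 0 := by
    exact_mod_cast (W.torsionOrder_pos W.finite_torsion_holds).ne'
  have hNK0 : ((V.baseChange K).torsionOrder : ℚ) ≠ 0 := by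
    exact_mod_cast ((V.baseChange K).torsionOrder_pos (V.baseChange K).finite_torsion_holds).ne'
  have hua0 : |(C.u : ℚ)| ≠ 0 := abs_ne_zero.mpr C.u.ne_zero
  have hLHS0 : ∀ {x : ℚ}, x ≠ 0 → (2 * x * (V.baseChange K).shaOrder *
      (Nat.card V.toAffine.Point : ℚ) ^ 2 * (W.torsionOrder : ℚ) ^ 2 : ℚ) ≠ 0 := fun hx ↦
    mul_ne_zero (mul_ne_zero (mul_ne_zero (mul_ne_zero two_ne_zero hx) hSK0) (pow_ne_zero 2 hNV0))
      (pow_ne_zero 2 hNW0)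
  have hM0 : (V.baseChange K).modifiedTamagawaProduct ≠ 0 := by
    intro hM
    have hRHS : V.bsdRHS * W.bsdRHS = 0 := by
      rw [← hWR, hM]; simp
    exact mul_ne_zero (V.bsdRHS_ne_zero hfinV) (W.bsdRHS_ne_zero hfinW) hRHS
  have hm0 : m ≠ 0 := by
    rintro rfl
    apply hLHS0 hM0
    rw [hcard]
    simp
  have hmq0 : (m : ℚ) ≠ 0 := by exact_mod_cast hm0
  refine ⟨hM0, hm0, ?_⟩
  have hv2 : padicValRat p (2 : ℚ) = 0 := by
    have h22 : ¬ p ∣ 2 := by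
      intro hd
      have hle : p ≤ 2 := Nat.le_of_dvd two_pos hd
      exact hp (le_antisymm hle (Fact.out : p.Prime).two_le)
    rw [show (2 : ℚ) = ((2 : ℕ) : ℚ) by norm_num, padicValRat.of_nat]
    exact_mod_cast padicValNat.eq_zero_of_not_dvd h22
  have hvcard := congrArg (padicValRat p) hcard
  rw [padicValRat.mul (mul_ne_zero (mul_ne_zero (mul_ne_zero two_ne_zero hM0) hSK0) (pow_ne_zero 2 hNV0))
      (pow_ne_zero 2 hNW0),
    padicValRat.mul (mul_ne_zero (mul_ne_zero two_ne_zero hM0) hSK0) (pow_ne_zero 2 hNV0),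
    padicValRat.mul (mul_ne_zero two_ne_zero hM0) hSK0, padicValRat.mul two_ne_zero hM0,
    padicValRat.pow, padicValRat.pow,
    padicValRat.mul (mul_ne_zero (mul_ne_zero (mul_ne_zero (mul_ne_zero (mul_ne_zero (mul_ne_zero
      (pow_ne_zero 2 hmq0) hnV0) hua0) hSV0) hSW0) hcV0) hcW0) (pow_ne_zero 2 hNK0),
    padicValRat.mul (mul_ne_zero (mul_ne_zero (mul_ne_zero (mul_ne_zero (mul_ne_zero
      (pow_ne_zero 2 hmq0) hnV0) hua0) hSV0) hSW0) hcV0) hcW0,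
    padicValRat.mul (mul_ne_zero (mul_ne_zero (mul_ne_zero (mul_ne_zero
      (pow_ne_zero 2 hmq0) hnV0) hua0) hSV0) hSW0) hcV0,
    padicValRat.mul (mul_ne_zero (mul_ne_zero (mul_ne_zero (pow_ne_zero 2 hmq0) hnV0) hua0) hSV0) hSW0,
    padicValRat.mul (mul_ne_zero (mul_ne_zero (pow_ne_zero 2 hmq0) hnV0) hua0) hSV0,
    padicValRat.mul (mul_ne_zero (pow_ne_zero 2 hmq0) hnV0) hua0,
    padicValRat.mul (pow_ne_zero 2 hmq0) hnV0, padicValRat.pow, padicValRat.pow, hv2,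
    padicValRat_numRealComponents_eq_zero V p hp,
    padicValRat.of_nat, padicValRat.of_nat, padicValRat.of_nat, padicValRat.of_nat,
    padicValRat.of_nat, padicValRat.of_nat, padicValRat.of_nat, padicValRat.of_nat] at hvcard
  push_cast at hvcard ⊢
  linarith

end OverQuadratic

/-! ## §3 A twisting transport `Φ : W(ℚ) →+ V(K)` doubling Néron–Tate heights exists -/

section Transport

/-- Transport along an EQUALITY of Weierstrass equations preserves the Néron–Tate pairing (it is the
identity on coordinates). [folklore] -/
theorem heightPairing_congrEquiv {F : Type*} [Field F] [NumberField F] [DecidableEq F] {W₁ W₂ : WeierstrassCurve F}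
    (h : W₁ = W₂) (P Q : W₁.toAffine.Point) :
    heightPairing (Affine.Point.congrEquiv h P) (Affine.Point.congrEquiv h Q) = heightPairing P Q := by
  subst h
  rfl

/-- A change of variables onto an EQUAL equation induces an isomorphism of point groups preserving the
Néron–Tate pairing on the diagonal (`pointEquiv` then `congrEquiv`; Silverman *AEC* VIII.9.3, the
canonical height is attached to the curve). Stated for the call-site `DecidableEq` instance (the group
law on points depends on it only propositionally; the underlying map `pointMap` does not).
[cite: SilvermanAEC2009, Thm. VIII.9.3 and Prop. III.3.1(b)] -/
theorem exists_addEquiv_heightPairing_eq_of_smul_eq {F : Type*} [Field F] [NumberField F] [DecidableEq F]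
    {W₁ W₂ : WeierstrassCurve F} (C : VariableChange F) (h : C • W₁ = W₂) :
    ∃ e : W₁.toAffine.Point ≃+ W₂.toAffine.Point,
      ∀ P : W₁.toAffine.Point, heightPairing (e P) (e P) = heightPairing P P := by
  refine ⟨(VariableChange.pointEquiv W₁ C).trans (Affine.Point.congrEquiv h), fun P ↦ ?_⟩
  rw [AddEquiv.trans_apply, heightPairing_congrEquiv]
  have h' := heightPairing_pointEquiv C P P
  simp only [VariableChange.pointEquiv_apply] at h' ⊢
  exact h'

/-- Re-bundling an additive map of point groups along a change of the `DecidableEq` instance used to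
DEFINE the group law on points (Mathlib's chord–tangent addition takes `[DecidableEq F]`; any two
instances are equal, `Subsingleton.elim`, so the bundled-hom types agree after substitution). Needed
because polymorphic constructions (`QuadraticDescent.twistMap`) carry the classical instance while
statements over `ℚ` elaborate `Rat`'s. [folklore] -/
theorem exists_addMonoidHom_coe_eq_of_decEq {F : Type*} [Field F] {W₁ : WeierstrassCurve F}
    {B : Type*} [AddZeroClass B] (d₁ d₂ : DecidableEq F)
    (f : letI : DecidableEq F := d₁; W₁.toAffine.Point →+ B) :
    ∃ g : (letI : DecidableEq F := d₂; W₁.toAffine.Point →+ B), ∀ P, g P = f P := by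
  have h : d₁ = d₂ := Subsingleton.elim d₁ d₂
  subst h
  exact ⟨f, fun _ ↦ rfl⟩

variable (K : Type) [Field K] [NumberField K] (V : WeierstrassCurve ℚ) [V.IsElliptic]
  (W : WeierstrassCurve ℚ) [W.IsElliptic]

omit [W.IsElliptic] in
/-- **Existence of a twisting transport.** For `K ⊇ ℚ` a quadratic number field containing
`θ ∉ ℚ` with `θ² = c`, and `W = C • V^{(c)}`, there is an additive map `Φ : W(ℚ) →+ V(K)` with
`⟨ΦP, ΦP⟩_K = 2·⟨P,P⟩_ℚ` for every `P ∈ W(ℚ)`: `Φ = e₁⁻¹ ∘ τ ∘ e₀⁻¹` with `τ` the twisting map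
`V^{(c)}(ℚ) → V^{(1)}(K)`, `(X,Y) ↦ (X/θ², Y/θ³)` (`QuadraticDescent.twistMap`: the inclusion to `K`,
which multiplies heights by `[K:ℚ] = 2`, Silverman *AEC* VIII.5.4(b), followed by the change of variables
`u = θ` over `K`, *AEC* X.5.4), `e₀ : V^{(c)}(ℚ) ≃ W(ℚ)` the change of variables `C`, and
`e₁ : V(K) ≃ V^{(1)}(K)` the completion of the square base-changed to `K` (changes of variables preserve
the canonical height, *AEC* VIII.9.3). [cite: SilvermanAEC2009, X.5 Cor. 5.4, Prop. VIII.5.4(b), Thm. VIII.9.3] -/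
theorem exists_twistTransport (h2 : Module.finrank ℚ K = 2) {θ : K} {c : ℚ}
    (hθ : θ ∉ Set.range (algebraMap ℚ K)) (hc : θ ^ 2 = algebraMap ℚ K c)
    (C : VariableChange ℚ) (hC : C • V.quadraticTwist c = W) :
    ∃ Φ : W.toAffine.Point →+ (V.baseChange K).toAffine.Point,
      ∀ P : W.toAffine.Point, heightPairing (Φ P) (Φ P) = 2 * heightPairing P P := by
  haveI : NeZero (2 : ℚ) := ⟨two_ne_zero⟩
  have hc0 : c ≠ 0 := by
    rintro rfl
    have hθ0 : θ = 0 := by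
      have h : θ ^ 2 = 0 := by rw [hc, _root_.map_zero]
      exact pow_eq_zero_iff (n := 2) two_ne_zero |>.mp h
    exact hθ ⟨0, by rw [_root_.map_zero, hθ0]⟩
  haveI : (V.quadraticTwist c).IsElliptic := V.isElliptic_quadraticTwist hc0
  haveI : (V.baseChange K).IsElliptic := by rw [WeierstrassCurve.baseChange]; infer_instance
  obtain ⟨C₁, hC₁⟩ := V.exists_variableChange_quadraticTwist_one
  have hC₁K : C₁.map (algebraMap ℚ K) • V.baseChange K = (V.quadraticTwist 1).baseChange K := by
    rw [← VariableChange.baseChange_smul_eq, hC₁]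
  -- the three maps with their height properties
  obtain ⟨e₀, he₀⟩ := exists_addEquiv_heightPairing_eq_of_smul_eq C hC
  obtain ⟨e₁, he₁⟩ := exists_addEquiv_heightPairing_eq_of_smul_eq (C₁.map (algebraMap ℚ K)) hC₁K
  -- the twisting map, re-bundled for the group law on `V^{(c)}(ℚ)` elaborated here
  obtain ⟨τ, hτf⟩ : ∃ g : (V.quadraticTwist c).toAffine.Point →+ ((V.quadraticTwist 1).baseChange K).toAffine.Point,
      ∀ P, g P = QuadraticDescent.twistMap V hθ hc P :=
    exists_addMonoidHom_coe_eq_of_decEq _ _ (QuadraticDescent.twistMap V hθ hc)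
  have hτ : ∀ R : (V.quadraticTwist c).toAffine.Point,
      heightPairing (τ R) (τ R) = 2 * heightPairing R R := by
    intro R
    rw [hτf]
    show heightPairing
        (Affine.Point.congrEquiv (twistUntwist_smul_baseChange V hθ hc)
          (VariableChange.pointEquiv _ (twistUntwist hθ) (QuadraticDescent.incl K (V.quadraticTwist c) R)))
        (Affine.Point.congrEquiv (twistUntwist_smul_baseChange V hθ hc)
          (VariableChange.pointEquiv _ (twistUntwist hθ) (QuadraticDescent.incl K (V.quadraticTwist c) R))) = _
    rw [heightPairing_congrEquiv, heightPairing_pointEquiv]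
    have h0 := heightPairing_baseChange (R := ℚ) (K := ℚ) (L := K) (W := V.quadraticTwist c) R R
    rw [h2] at h0
    push_cast at h0
    exact h0
  have he₁' : ∀ X, heightPairing (e₁.symm X) (e₁.symm X) = heightPairing X X := fun X ↦ by
    conv_rhs => rw [← e₁.apply_symm_apply X]
    exact (he₁ (e₁.symm X)).symm
  have he₀' : ∀ P, heightPairing (e₀.symm P) (e₀.symm P) = heightPairing P P := fun P ↦ by
    conv_rhs => rw [← e₀.apply_symm_apply P]
    exact (he₀ (e₀.symm P)).symm
  refine ⟨e₁.symm.toAddMonoidHom.comp (τ.comp e₀.symm.toAddMonoidHom), fun P ↦ ?_⟩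
  rw [AddMonoidHom.comp_apply, AddMonoidHom.comp_apply, AddEquiv.coe_toAddMonoidHom,
    AddEquiv.coe_toAddMonoidHom, he₁', hτ, he₀']

end Transport

end Summit.BirchSwinnertonDyer.Rank1Residual.Additive

end
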